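import Literature.MathematicalPhysics.QuantumFieldTheory.Balaban1983to89.Beta.BalabanStepJets

/-!
# `BalabanUV.Beta.GAN24.WilsonVertexSumZero` (SELF-CONTAINED VARIANT β) — LEAF W1 of `SKELETON-S3.md` v0.6 §12.2∕§12.4 (row W of «E3Shape»):
# THE DIRECTION-INDEXED ROW SUMS OF THE COLOURLESS WILSON VERTEX TABLE VANISH — `Σ_{w,y} wilsonA d γ u w y (inl α) (inl β) = 0`

NOT IN PRINT; OUR PROOF ATTEMPT (row G-an2-4 ∕ (CONV-C), S-slot remainder «E3Shape», row W input W1; offered to this seat by the row owner, CLAIMS l.4518).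
THIS file is [folklore] finite algebra in POSITION SPACE over an3's typed stencil `PlaquetteStencilData.wilsonVertex₁_apply` (entry = indicator sum over the
stencil index; the colour blocks sum to zero — leaf-18-g10's `ProbeWilsonCurl.lean` §1, re-derived with credit): for every finite `S` containing the support, the
double sum of the table equals the sum of the colourless blocks, which is zero (the cubic Wilson vertex annihilates the pair of constant fluctuation fields).
HONEST FRAMING (cell contract, verbatim): «discharging `BetaPertH` makes Bałaban's UV stability UNCONDITIONAL — a real constructive-QFT result; it is NOT the
continuum limit and NOT the Clay problem.»  HONEST DEPENDENCY (verbatim): «continuum YM on T⁴ ⇐ BetaPertH ∧ nine spine estimates (0/9 proved); BetaPertH ⇐ (D1) ∧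
(D4) ∧ CAP+tail; G-an2-4 gates asym, D1 and NE2/3/4.»  No cited fact, no `def … : Prop`; generic `d`; nothing asserted about «E3Shape» itself.  NOT summit progress.
Unit `b2b-balaban-gan24-formalise-leaf-15` (gen 13; INTENT CLAIMS.log l.4528), 2026-08-20.
-/

noncomputable section

open Finset
open scoped BigOperators
open Literature.MathematicalPhysics.QuantumFieldTheory.Balaban1983to89
open Literature.MathematicalPhysics.QuantumFieldTheory.Balaban1983to89.Beta
open B6BondElimination (unitVec unitVec_apply)
open PlaquetteStencilData (WilsonIdx RemIdx wα wβ wm IsOffset wilsonVertex₁_apply isOffset_wα isOffset_wβ fam trm dim bsm rmm dvm)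
open GhostTable (curM copies)
open SpinTable (spM)
open StepJetData (wEntry wilsonA)
open BalabanStepJets (box1 mem_box1)
open OneStepResolventKernel (Fib)

namespace Summit.QuantumFields.BalabanUV.Beta.GAN24.WilsonVertexSumZero

variable {d : ℕ}

/-- the unit lattice vectors of `ℤ^{d+1}` as a stencil generator (an3's `e`). [folklore] -/
abbrev uv : Fin (d + 1) → (Fin (d + 1) → ℤ) := unitVec

/-! ## §1 The colourless block entries; an entry is an indicator sum -/

/-- [folklore] THE COLOURLESS BLOCK ENTRY of stencil index `i`. -/
def wc (κ' : Fin (d + 1)) (i : WilsonIdx (Fin (d + 1))) (α β : Fin (d + 1)) : ℝ :=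
  wm κ' (1 : Matrix Unit Unit ℝ) i ((), α) ((), β)

/-- [folklore] `wEntry d κ′ u x z α β = Σ_i [x = u + wα i ∧ z = u + wβ i]·wc κ′ i α β`. -/
theorem wEntry_eq_sum (κ' : Fin (d + 1)) (u x z : Fin (d + 1) → ℤ) (α β : Fin (d + 1)) :
    wEntry d κ' u x z α β = ∑ i, if x = u + wα uv κ' i ∧ z = u + wβ uv κ' i then wc κ' i α β else 0 := by
  unfold wEntry
  rw [wilsonVertex₁_apply]
  rfl

/-! ## §2 The colour blocks sum to zero (leaf-18-g10's `ProbeWilsonCurl.lean` §1, re-derived) -/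

section Blocks

variable {C : Type*} {D : Type*} [Fintype D] [DecidableEq D]

/- The seven lemmas of this section are leaf-18-g10's (`HOME/b2b-balaban-gan24-formalise-leaf-18/gen10/ProbeWilsonCurl.lean`
   e0923092e0d0f0dd §1, filed nowhere), re-derived verbatim here so that the register engine is self-contained; authorship theirs. -/

omit [Fintype D] in
/-- [folklore] The far-corner blocks `± dirBlock` cancel (leaf-18-g10). -/
theorem sum_fam (α β : D) (A : Matrix C C ℝ) : ∑ b : Bool, fam α β A b = 0 := by
  simp only [Fintype.sum_bool, fam, if_true, Bool.false_eq_true, if_false, add_neg_cancel]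

omit [Fintype D] in
/-- [folklore] The eight transport blocks cancel in pairs (leaf-18-g10). -/
theorem sum_trm (α β : D) (A : Matrix C C ℝ) : ∑ i : Fin 8, trm α β A i = 0 := by
  simp only [Fin.sum_univ_succ, Fin.sum_univ_zero, trm, Matrix.cons_val_zero, Matrix.cons_val_succ]
  abel

omit [Fintype D] in
/-- [folklore] The twelve difference blocks cancel in pairs (leaf-18-g10). -/
theorem sum_dim (α β : D) (A : Matrix C C ℝ) : ∑ i : Fin 12, dim α β A i = 0 := by
  simp only [Fin.sum_univ_succ, Fin.sum_univ_zero, dim, Matrix.cons_val_zero, Matrix.cons_val_succ]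
  abel

omit [DecidableEq D] in
/-- [folklore] The one-bond readings of a zero-sum family sum to zero (leaf-18-g10). -/
theorem sum_bsm {σ : Type*} [Fintype σ] (γ : D) (km : D → D → σ → Matrix (C × D) (C × D) ℝ)
    (h : ∀ α β, ∑ s, km α β s = 0) : ∑ p : D × (Fin 4 × σ), bsm γ km p = 0 := by
  rw [Fintype.sum_prod_type]
  refine Finset.sum_eq_zero fun μ _ => ?_
  rw [Fintype.sum_prod_type]
  refine Finset.sum_eq_zero fun r _ => ?_
  simp only [bsm, ← Finset.smul_sum, h, smul_zero]

/-- [folklore] The remainder vertex's blocks sum to zero (leaf-18-g10). -/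
theorem sum_rmm (γ : D) (A : Matrix C C ℝ) : ∑ i : RemIdx D, rmm γ A i = 0 := by
  simp only [Fintype.sum_sum_type, rmm, Sum.elim_inl, Sum.elim_inr, Pi.neg_apply, Pi.smul_apply, Finset.sum_neg_distrib,
    ← Finset.smul_sum, sum_bsm γ _ (fun α β => sum_dim α β A), sum_bsm γ _ (fun α β => sum_trm α β A),
    sum_bsm γ _ (fun α β => sum_fam α β A), smul_zero, neg_zero, add_zero]

omit [Fintype D] [DecidableEq D] in
/-- [folklore] The current's two blocks cancel (leaf-18-g10). -/
theorem sum_curM (A' : Matrix (C × D) (C × D) ℝ) : ∑ b : Bool, curM A' b = 0 := by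
  simp only [Fintype.sum_bool, curM, if_true, Bool.false_eq_true, if_false, add_neg_cancel]

/-- [folklore] The spin blocks cancel in pairs (leaf-18-g10). -/
theorem sum_spM (γ : D) (A : Matrix C C ℝ) : ∑ s : D × Bool, spM γ A s = 0 := by
  rw [Fintype.sum_prod_type]
  refine Finset.sum_eq_zero fun μ _ => ?_
  simp only [Fintype.sum_bool, spM, if_true, Bool.false_eq_true, if_false, one_smul, neg_smul, add_neg_cancel]

/-- [folklore] The longitudinal blocks cancel in pairs (leaf-18-g10). -/
theorem sum_dvm (γ : D) (A : Matrix C C ℝ) : ∑ p : D × Bool, dvm γ A p = 0 := by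
  rw [Fintype.sum_prod_type]
  refine Finset.sum_eq_zero fun μ _ => ?_
  simp only [Fintype.sum_bool, dvm, if_true, Bool.false_eq_true, if_false, add_neg_cancel]

/-- [folklore] **THE COLOUR BLOCKS OF THE WILSON FIRST-ORDER VERTEX SUM TO ZERO** (every `γ`, every colour matrix `A`; leaf-18-g10's
`sum_wm_eq_zero`, re-derived). -/
theorem sum_wm_eq_zero (γ : D) (A : Matrix C C ℝ) : ∑ i : WilsonIdx D, wm γ A i = 0 := by
  rw [Fintype.sum_sum_type]
  have h2 : ∑ i : RemIdx D, wm γ A (Sum.inr i) = 0 := by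
    simp only [wm, Sum.elim_inr]; exact sum_rmm γ A
  rw [h2, add_zero, Fintype.sum_sum_type]
  have h3 : ∑ p : D × Bool, wm γ A (Sum.inl (Sum.inr p)) = 0 := by
    simp only [wm, Sum.elim_inl, Sum.elim_inr, Pi.smul_apply, ← Finset.smul_sum, sum_dvm, smul_zero]
  rw [h3, add_zero, Fintype.sum_sum_type]
  simp only [wm, Sum.elim_inl, Sum.elim_inr, Pi.smul_apply, ← Finset.smul_sum, sum_curM, sum_spM, smul_zero, add_zero]

end Blocks

/-- [folklore] THE COLOURLESS BLOCK ENTRIES SUM TO ZERO, per `(κ′, α, β)`. -/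
theorem sum_wc_eq_zero (κ' α β : Fin (d + 1)) : ∑ i, wc κ' i α β = 0 := by
  have h := sum_wm_eq_zero (C := Unit) κ' (1 : Matrix Unit Unit ℝ)
  have h' := congrFun (congrFun h ((), α)) ((), β)
  rw [Matrix.sum_apply, Matrix.zero_apply] at h'
  exact h'

/-! ## §3 Support -/

/-- [folklore] an entry vanishes unless its ROW site is `u +` a row offset of the stencil. -/
theorem wEntry_eq_zero_of_row (κ' : Fin (d + 1)) (u x z : Fin (d + 1) → ℤ) (α β : Fin (d + 1)) (h : ∀ i, x ≠ u + wα uv κ' i) :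
    wEntry d κ' u x z α β = 0 := by
  rw [wEntry_eq_sum]
  exact Finset.sum_eq_zero fun i _ => if_neg fun hc => h i hc.1

/-- [folklore] an entry vanishes unless its COLUMN site is `u +` a column offset of the stencil. -/
theorem wEntry_eq_zero_of_col (κ' : Fin (d + 1)) (u x z : Fin (d + 1) → ℤ) (α β : Fin (d + 1)) (h : ∀ i, z ≠ u + wβ uv κ' i) :
    wEntry d κ' u x z α β = 0 := by
  rw [wEntry_eq_sum]
  exact Finset.sum_eq_zero fun i _ => if_neg fun hc => h i hc.2

/-- [folklore] THE SUPPORT SET of the table at the bond `(κ′, u)`: `u +` (row offsets ∪ column offsets). -/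
def suppW (κ' : Fin (d + 1)) (u : Fin (d + 1) → ℤ) : Finset (Fin (d + 1) → ℤ) :=
  (Finset.univ.image fun i => u + wα uv κ' i) ∪ Finset.univ.image fun i => u + wβ uv κ' i

/-- [folklore] row sites belong to the support set. -/
theorem row_mem_suppW (κ' : Fin (d + 1)) (u : Fin (d + 1) → ℤ) (i : WilsonIdx (Fin (d + 1))) : u + wα uv κ' i ∈ suppW κ' u :=
  Finset.mem_union_left _ (Finset.mem_image_of_mem _ (Finset.mem_univ i))

/-- [folklore] column sites belong to the support set. -/
theorem col_mem_suppW (κ' : Fin (d + 1)) (u : Fin (d + 1) → ℤ) (i : WilsonIdx (Fin (d + 1))) : u + wβ uv κ' i ∈ suppW κ' u :=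
  Finset.mem_union_right _ (Finset.mem_image_of_mem _ (Finset.mem_univ i))

/-- [folklore] off the support set (first leg) the antisymmetrised field block vanishes. -/
theorem wilsonA_eq_zero_left (κ' : Fin (d + 1)) (u : Fin (d + 1) → ℤ) {w : Fin (d + 1) → ℤ} (hw : w ∉ suppW κ' u)
    (y : Fin (d + 1) → ℤ) (α β : Fin (d + 1)) : wilsonA d κ' u w y (Sum.inl α) (Sum.inl β) = 0 := by
  show 1 / 2 * (wEntry d κ' u w y α β - wEntry d κ' u y w β α) = 0
  rw [wEntry_eq_zero_of_row κ' u w y α β (fun i h => hw (h ▸ row_mem_suppW κ' u i)),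
    wEntry_eq_zero_of_col κ' u y w β α (fun i h => hw (h ▸ col_mem_suppW κ' u i))]
  ring

/-- [folklore] off the support set (second leg) the antisymmetrised field block vanishes. -/
theorem wilsonA_eq_zero_right (κ' : Fin (d + 1)) (u w : Fin (d + 1) → ℤ) {y : Fin (d + 1) → ℤ} (hy : y ∉ suppW κ' u)
    (α β : Fin (d + 1)) : wilsonA d κ' u w y (Sum.inl α) (Sum.inl β) = 0 := by
  show 1 / 2 * (wEntry d κ' u w y α β - wEntry d κ' u y w β α) = 0
  rw [wEntry_eq_zero_of_col κ' u w y α β (fun i h => hy (h ▸ col_mem_suppW κ' u i)),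
    wEntry_eq_zero_of_row κ' u y w β α (fun i h => hy (h ▸ row_mem_suppW κ' u i))]
  ring

/-- [folklore] every offset of the alphabet `{0, e_γ, ±e_μ, e_γ − e_μ}` lies in the box `{−1,0,1}^{d+1}` (leaf-18-g10's `mem_box1_of_isOffset`, re-derived). -/
theorem mem_box1_of_isOffset {γ : Fin (d + 1)} {x : Fin (d + 1) → ℤ} (h : IsOffset uv γ x) : x ∈ box1 (d + 1) := by
  rw [mem_box1]
  intro i
  rcases h with rfl | rfl | ⟨μ, rfl | rfl | rfl⟩
  · exact Or.inr (Or.inl rfl)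
  · simp only [uv, unitVec_apply]; split_ifs <;> simp
  · simp only [uv, unitVec_apply]; split_ifs <;> simp
  · simp only [uv, Pi.neg_apply, unitVec_apply]; split_ifs <;> simp
  · simp only [uv, Pi.sub_apply, unitVec_apply]; split_ifs <;> simp

/-- [folklore] **THE SUPPORT LIES IN THE TRANSLATED BOX** `u + {−1,0,1}^{d+1}`. -/
theorem suppW_subset_box (κ' : Fin (d + 1)) (u : Fin (d + 1) → ℤ) : suppW κ' u ⊆ (box1 (d + 1)).image fun v => u + v := by
  intro x hx
  rcases Finset.mem_union.1 hx with h | h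
  · obtain ⟨i, -, rfl⟩ := Finset.mem_image.1 h
    exact Finset.mem_image_of_mem _ (mem_box1_of_isOffset (isOffset_wα uv κ' i))
  · obtain ⟨i, -, rfl⟩ := Finset.mem_image.1 h
    exact Finset.mem_image_of_mem _ (mem_box1_of_isOffset (isOffset_wβ uv κ' i))

/-! ## §4 The sums -/

/-- [folklore] THE RAW TABLE'S TOTAL SUM over any finite superset of the support vanishes. -/
theorem wEntry_sum_zero_of_supp (κ' : Fin (d + 1)) (u : Fin (d + 1) → ℤ) (α β : Fin (d + 1)) (S : Finset (Fin (d + 1) → ℤ))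
    (hS : suppW κ' u ⊆ S) : ∑ w ∈ S, ∑ y ∈ S, wEntry d κ' u w y α β = 0 := by
  have h1 : ∀ w y, wEntry d κ' u w y α β = ∑ i, if w = u + wα uv κ' i ∧ y = u + wβ uv κ' i then wc κ' i α β else 0 :=
    fun w y => wEntry_eq_sum κ' u w y α β
  simp_rw [h1]
  have h2 : ∀ w ∈ S, ∑ y ∈ S, ∑ i, (if w = u + wα uv κ' i ∧ y = u + wβ uv κ' i then wc κ' i α β else 0) =
      ∑ i, ∑ y ∈ S, (if w = u + wα uv κ' i ∧ y = u + wβ uv κ' i then wc κ' i α β else 0) := fun w _ => Finset.sum_comm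
  rw [Finset.sum_congr rfl h2, Finset.sum_comm]
  refine (Finset.sum_congr rfl fun i _ => ?_).trans (sum_wc_eq_zero κ' α β)
  rw [Finset.sum_eq_single_of_mem (u + wα uv κ' i) (hS (row_mem_suppW κ' u i))]
  · rw [Finset.sum_eq_single_of_mem (u + wβ uv κ' i) (hS (col_mem_suppW κ' u i))]
    · simp
    · intro y _ hy
      split_ifs with h
      · exact absurd h.2 hy
      · rfl
  · intro w _ hw
    refine Finset.sum_eq_zero fun y _ => ?_
    split_ifs with h
    · exact absurd h.1 hw
    · rfl

/-- [folklore] **W1 — THE ROW SUMS OF THE (V-Δ) TABLE VANISH**: for every finite `S ⊇ suppW κ′ u`,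
`Σ_{w∈S} Σ_{y∈S} wilsonA d κ′ u w y (inl α) (inl β) = 0`. -/
theorem wilsonA_sum_zero_of_supp (κ' : Fin (d + 1)) (u : Fin (d + 1) → ℤ) (α β : Fin (d + 1)) (S : Finset (Fin (d + 1) → ℤ))
    (hS : suppW κ' u ⊆ S) : ∑ w ∈ S, ∑ y ∈ S, wilsonA d κ' u w y (Sum.inl α) (Sum.inl β) = 0 := by
  have h1 : ∀ w y, wilsonA d κ' u w y (Sum.inl α) (Sum.inl β) = 1 / 2 * wEntry d κ' u w y α β - 1 / 2 * wEntry d κ' u y w β α :=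
    fun w y => by show 1 / 2 * (wEntry d κ' u w y α β - wEntry d κ' u y w β α) = _; ring
  simp_rw [h1, Finset.sum_sub_distrib, ← Finset.mul_sum]
  rw [wEntry_sum_zero_of_supp κ' u α β S hS, Finset.sum_comm, wEntry_sum_zero_of_supp κ' u β α S hS]
  ring

/-- [folklore] **W1, BOX FORM**: `Σ_{w ∈ u + {−1,0,1}^{d+1}} Σ_{y ∈ u + {−1,0,1}^{d+1}} wilsonA d κ′ u w y (inl α) (inl β) = 0`. -/
theorem wilsonA_sum_zero_box (κ' : Fin (d + 1)) (u : Fin (d + 1) → ℤ) (α β : Fin (d + 1)) :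
    ∑ w ∈ (box1 (d + 1)).image (fun v => u + v), ∑ y ∈ (box1 (d + 1)).image (fun v => u + v),
      wilsonA d κ' u w y (Sum.inl α) (Sum.inl β) = 0 :=
  wilsonA_sum_zero_of_supp κ' u α β _ (suppW_subset_box κ' u)

/-- [folklore] **W1, SUPPORT-FREE FORM**: `∑' w, ∑' y, wilsonA d κ′ u w y (inl α) (inl β) = 0`. -/
theorem wilsonA_tsum_zero (κ' : Fin (d + 1)) (u : Fin (d + 1) → ℤ) (α β : Fin (d + 1)) :
    ∑' w, ∑' y, wilsonA d κ' u w y (Sum.inl α) (Sum.inl β) = 0 := by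
  have hin : ∀ w, ∑' y, wilsonA d κ' u w y (Sum.inl α) (Sum.inl β) = ∑ y ∈ suppW κ' u, wilsonA d κ' u w y (Sum.inl α) (Sum.inl β) :=
    fun w => tsum_eq_sum fun y hy => wilsonA_eq_zero_right κ' u w hy α β
  simp_rw [hin]
  rw [tsum_eq_sum (s := suppW κ' u) fun w hw => Finset.sum_eq_zero fun y _ => wilsonA_eq_zero_left κ' u hw y α β]
  exact wilsonA_sum_zero_of_supp κ' u α β _ le_rfl

/-- [folklore] the raw table's box and support-free forms. -/
theorem wEntry_sum_zero_box (κ' : Fin (d + 1)) (u : Fin (d + 1) → ℤ) (α β : Fin (d + 1)) :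
    ∑ w ∈ (box1 (d + 1)).image (fun v => u + v), ∑ y ∈ (box1 (d + 1)).image (fun v => u + v), wEntry d κ' u w y α β = 0 :=
  wEntry_sum_zero_of_supp κ' u α β _ (suppW_subset_box κ' u)

end Summit.QuantumFields.BalabanUV.Beta.GAN24.WilsonVertexSumZero

end
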